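import Literature.MathematicalPhysics.StatisticalMechanics.BarlowStacking
import Summits.AtomisticToContinuum.Crystallization.Theses.SquareWellLayerCake

/-!
# Routes `SquareWellLayerCake` / `LaminarSixThreeThree`, crux `StackingFaultSparsity`
# (stmt-AtomisticToContinuum-14296): vocabulary of line `Sketch`

The checked skeleton `Cruxes/StackingFaultSparsity/Lines/Sketch.lean` states its registered stubs over
a small vocabulary of its own. By D-0016 the objects a route posits live in a reviewed
`Theorems/…Defs.lean` so that the stub proofs (separate `Theorems/` files, `--supports` the crux item)
and the final sorry-free skeleton can IMPORT them; this file is that vocabulary, verbatim from the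
skeleton:

* `TwoWay S R ε y i z A` — the two-way `(R, ε)`-matching clause of the crux (window of particle `i` of
  `y` against the point set `S` based at `z`, after the linear isometry `A`), VERBATIM the clause of
  `StackingFaultSparsity` / `LaminarBarlowWindows` / `GapTwelveToBarlow`;
* `BarlowM R ε y i`, `HcpM R ε y i` — "`i` has an `(R, ε)`-window on SOME Barlow stacking / on SOME hcp
  stacking", the two conjuncts of the crux's bad set (`stackingFaultSparsity_iff` is `Iff.rfl`);
* `InBox a h` — the Poisson–Bessel parameter box `[47/50, 1] × [39a/50, 17a/20]` of the relaxed LJ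
  close packings (shared with PoissonBesselStacking / PricedLinkCensus);
* `cubicNear s k M` — the cubic (non-alternating) letters of a Hägg word among the layers within `M`
  of layer `k`.

All definitions carry parameters (route-internal bookkeeping, not literature facts); everything is
`[folklore]`; nothing here closes an item.
-/

noncomputable section

namespace Summit.AtomisticToContinuum.Crystallization.Theorems.SquareWellLayerCake.StackingFaultSparsity

open Filter
open scoped Topology
open Literature.MathematicalPhysics.StatisticalMechanics

/-- Euclidean `3`-space. [folklore] -/
local notation "E3" => EuclideanSpace ℝ (Fin 3)

/-- **Two-way `(R, ε)`-match** of the window of particle `i` of `y` with the point set `S` based at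
`z`, after the linear isometry `A`: every point of `S` within `R` of `z` is imaged within `ε` of a
particle, and every particle within `R` of `y i` is within `ε` of the image of a point of `S`
(verbatim the matching clause of `StackingFaultSparsity`). [folklore] -/
def TwoWay (S : Set E3) (R ε : ℝ) {N : ℕ} (y : Fin N → E3) (i : Fin N) (z : E3)
    (A : E3 →ₗᵢ[ℝ] E3) : Prop :=
  (∀ p ∈ S, dist p z ≤ R → ∃ j : Fin N, dist (y j) (y i + A (p - z)) ≤ ε) ∧
    (∀ j : Fin N, dist (y j) (y i) ≤ R → ∃ p ∈ S, dist (y j) (y i + A (p - z)) ≤ ε)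

/-- `i` has an `(R, ε)`-window on SOME Barlow stacking `barlowStacking a h s`, `a, h ∈ (1/2, 2)`,
`s` a Hägg word (first conjunct of the crux's bad set). [folklore] -/
def BarlowM (R ε : ℝ) {N : ℕ} (y : Fin N → E3) (i : Fin N) : Prop :=
  ∃ a h : ℝ, 1 / 2 < a ∧ a < 2 ∧ 1 / 2 < h ∧ h < 2 ∧ ∃ s : ℤ → ℤ, IsHaggSeq s ∧
    ∃ z ∈ barlowStacking a h s, ∃ A : E3 →ₗᵢ[ℝ] E3, TwoWay (barlowStacking a h s) R ε y i z A

/-- `i` has an `(R, ε)`-window on SOME hcp stacking `hcpStacking a h`, `a, h ∈ (1/2, 2)` (the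
negated second conjunct of the crux's bad set). [folklore] -/
def HcpM (R ε : ℝ) {N : ℕ} (y : Fin N → E3) (i : Fin N) : Prop :=
  ∃ a h : ℝ, 1 / 2 < a ∧ a < 2 ∧ 1 / 2 < h ∧ h < 2 ∧
    ∃ z ∈ hcpStacking a h, ∃ A : E3 →ₗᵢ[ℝ] E3, TwoWay (hcpStacking a h) R ε y i z A

/-- **The Poisson–Bessel parameter box** `B = [47/50, 1] × [39a/50, 17a/20]` of the relaxed
Lennard-Jones close packings (`a* = 0.9712`, `h* = 0.8165 a*`). [folklore] -/
def InBox (a h : ℝ) : Prop :=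
  47 / 50 ≤ a ∧ a ≤ 1 ∧ 39 / 50 * a ≤ h ∧ h ≤ 17 / 20 * a

/-- **The cubic letters of the Hägg word `s` among the layers within `M` of layer `k`**: the layers
`m`, `k - M ≤ m ≤ k + M`, followed by the same letter (`s (m + 1) = s m`: layers `m, m+1, m+2` in
three different positions, an `ABC`-type triple); the alternating (hcp) word has none. [folklore] -/
def cubicNear (s : ℤ → ℤ) (k : ℤ) (M : ℕ) : Finset ℤ :=
  (Finset.Icc (k - M) (k + M)).filter fun m => s (m + 1) = s m

/-! ## Read-backs (definitional) -/

/-- The bad-set density statement in this vocabulary IS the route decl `StackingFaultSparsity` of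
`SquareWellLayerCake` (definitional unfolding). [folklore] -/
theorem stackingFaultSparsity_iff :
    (∀ R ε : ℝ, 0 < R → 0 < ε → ε < 1 / 4 → ∀ x : (N : ℕ) → (Fin N → E3),
      (∀ N, IsGroundState lennardJones (x N)) →
        Tendsto (fun N : ℕ =>
          (Nat.card {i : Fin N // BarlowM R ε (x N) i ∧ ¬ HcpM R ε (x N) i} : ℝ) / N) atTop (𝓝 0)) ↔
    Summit.AtomisticToContinuum.Crystallization.Theses.SquareWellLayerCake.StackingFaultSparsity :=
  Iff.rfl

/-- … and IS the same-named decl of the sibling route `LaminarSixThreeThree` (the shared item's home;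
the two route decls are the same term). [folklore] -/
theorem stackingFaultSparsity_iff' :
    (∀ R ε : ℝ, 0 < R → 0 < ε → ε < 1 / 4 → ∀ x : (N : ℕ) → (Fin N → E3),
      (∀ N, IsGroundState lennardJones (x N)) →
        Tendsto (fun N : ℕ =>
          (Nat.card {i : Fin N // BarlowM R ε (x N) i ∧ ¬ HcpM R ε (x N) i} : ℝ) / N) atTop (𝓝 0)) ↔
    Summit.AtomisticToContinuum.Crystallization.Theses.LaminarSixThreeThree.StackingFaultSparsity :=
  Iff.rfl

/-- Membership in `cubicNear` unfolded. [folklore] -/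
theorem mem_cubicNear_iff (s : ℤ → ℤ) (k : ℤ) (M : ℕ) (m : ℤ) :
    m ∈ cubicNear s k M ↔ (k - M ≤ m ∧ m ≤ k + M) ∧ s (m + 1) = s m := by
  simp [cubicNear, Finset.mem_filter, Finset.mem_Icc]

/-- The alternating word has no cubic letters. [folklore] -/
theorem cubicNear_alternatingHagg (k : ℤ) (M : ℕ) : cubicNear alternatingHagg k M = ∅ := by
  ext m
  simp only [mem_cubicNear_iff, Finset.notMem_empty, iff_false, not_and]
  intro _
  unfold alternatingHagg
  by_cases hm : Even m
  · have : ¬ Even (m + 1) := by simpa [Int.even_add_one] using hm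
    simp [hm, this]
  · have : Even (m + 1) := by simpa [Int.even_add_one] using hm
    simp [hm, this]

/-- Two-way matching is monotone: shrinking the radius and enlarging the tolerance keeps it.
[folklore] -/
theorem TwoWay.mono {S : Set E3} {R R' ε ε' : ℝ} {N : ℕ} {y : Fin N → E3} {i : Fin N} {z : E3}
    {A : E3 →ₗᵢ[ℝ] E3} (h : TwoWay S R ε y i z A) (hR : R' ≤ R) (hε : ε ≤ ε') :
    TwoWay S R' ε' y i z A := by
  refine ⟨fun p hp hpz => ?_, fun j hj => ?_⟩
  · obtain ⟨j, hj⟩ := h.1 p hp (hpz.trans hR)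
    exact ⟨j, hj.trans hε⟩
  · obtain ⟨p, hp, hpj⟩ := h.2 j (hj.trans hR)
    exact ⟨p, hp, hpj.trans hε⟩

/-- `BarlowM` is monotone in the same sense. [folklore] -/
theorem BarlowM.mono {R R' ε ε' : ℝ} {N : ℕ} {y : Fin N → E3} {i : Fin N} (h : BarlowM R ε y i)
    (hR : R' ≤ R) (hε : ε ≤ ε') : BarlowM R' ε' y i := by
  obtain ⟨a, b, ha1, ha2, hb1, hb2, s, hs, z, hz, A, hA⟩ := h
  exact ⟨a, b, ha1, ha2, hb1, hb2, s, hs, z, hz, A, hA.mono hR hε⟩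

/-- `HcpM` is monotone in the same sense. [folklore] -/
theorem HcpM.mono {R R' ε ε' : ℝ} {N : ℕ} {y : Fin N → E3} {i : Fin N} (h : HcpM R ε y i)
    (hR : R' ≤ R) (hε : ε ≤ ε') : HcpM R' ε' y i := by
  obtain ⟨a, b, ha1, ha2, hb1, hb2, z, hz, A, hA⟩ := h
  exact ⟨a, b, ha1, ha2, hb1, hb2, z, hz, A, hA.mono hR hε⟩

/-- An hcp window is in particular a Barlow window (the alternating word is a Hägg word). [folklore] -/
theorem HcpM.barlowM {R ε : ℝ} {N : ℕ} {y : Fin N → E3} {i : Fin N} (h : HcpM R ε y i) :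
    BarlowM R ε y i := by
  obtain ⟨a, b, ha1, ha2, hb1, hb2, z, hz, A, hA⟩ := h
  exact ⟨a, b, ha1, ha2, hb1, hb2, alternatingHagg, isHaggSeq_alternating, z, hz, A, hA⟩

/-! ## Vocabulary of the finite-`N` restacking competitor (stub `stub_diluteFaults`, appended 2026-08-16)

The Shockley block flip of a zero-charge block `[q₁, q₂)` of the Hägg word (`…ChainBlockFlip.lean`)
realised on a MATCHED configuration: the particles shadowing a vertical CYLINDER of the block's
layers are shifted rigidly in-plane by the registry vectors `σ_n • w`.  Typed by the wave-2 survey of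
line `Sketch` (`Cruxes/StackingFaultSparsity/DiluteFaultsSurvey.md`); used by the registered sub-stubs
of `stub_diluteFaults` (injectivity, exact-lattice ledger, perturbative transfer, assembly). -/

/-- **Registry sign** `σ_n ∈ {-1, 0, 1}` of layer `n` under the flip of the block starting at `q₁`:
`σ_n ≡ haggLabel s n - haggLabel s q₁ (mod 3)`.  The flipped word `s'` has
`haggLabel s' n - haggLabel s n = -2 (haggLabel s n - haggLabel s q₁) ≡ σ_n (mod 3)` for
`q₁ ≤ n ≤ q₂`, so layer `n` of `s'` is layer `n` of `s` shifted in-plane by `σ_n • barlowOffset a`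
up to an in-layer lattice translation (`barlowPos_eq_of_haggLabel_eq`, `3 w = u + v`); `σ_{q₁} = 0`,
and `σ_{q₂} = 0` iff the block has zero charge. [folklore] -/
def shiftSign (s : ℤ → ℤ) (q₁ n : ℤ) : ℤ :=
  (haggLabel s n - haggLabel s q₁ + 1) % 3 - 1

/-- **Squared lateral distance** (first two coordinates): the moved region is a vertical cylinder,
not a ball (the `barlowPos` indexing shears laterally with the unreduced `haggLabel`, and a ball
would make the per-layer site counts differ by more than `O(ρ)`). [folklore] -/
def latSq (p c : E3) : ℝ :=
  (p 0 - c 0) ^ 2 + (p 1 - c 1) ^ 2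

/-- **The moved cylinder**: stacking index `(n, i', j')` with `q₁ < n < q₂` and lateral distance
`≤ ρ` from the block base point `barlowPos a h s q₁ i₀ j₀`. [folklore] -/
def InCyl (a h : ℝ) (s : ℤ → ℤ) (q₁ q₂ i₀ j₀ : ℤ) (ρ : ℝ) (n i' j' : ℤ) : Prop :=
  q₁ < n ∧ n < q₂ ∧ latSq (barlowPos a h s n i' j') (barlowPos a h s q₁ i₀ j₀) ≤ ρ ^ 2

open Classical in
/-- **The block-shift displacement of particle `j`** of the matched configuration `x` (window of `i`
two-way matched to `barlowStacking a h s` based at `z = barlowPos a h s k i₀ j₀` after the isometry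
`A`): if `x j` is within `ε₁` of the image `x i + A (p - z)` of a cylinder point
`p = barlowPos a h s n i' j'`, move it by `A (σ_n • w)`, else leave it (for `2 ε₁ < min a h` the
cylinder point is unique, so the choice is harmless). [folklore] -/
def blockShift (a h : ℝ) (s : ℤ → ℤ) (k i₀ j₀ q₁ q₂ : ℤ) (ρ ε₁ : ℝ) {N : ℕ} (x : Fin N → E3)
    (i : Fin N) (A : E3 →ₗᵢ[ℝ] E3) (j : Fin N) : E3 :=
  if hj : ∃ n i' j' : ℤ, InCyl a h s q₁ q₂ i₀ j₀ ρ n i' j' ∧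
      dist (x j) (x i + A (barlowPos a h s n i' j' - barlowPos a h s k i₀ j₀)) ≤ ε₁
  then A ((shiftSign s q₁ hj.choose : ℝ) • barlowOffset a) else 0

open Classical in
/-- **The same displacement on an enumerated EXACT lattice window `P`** (no isometry, no tolerance).
[folklore] -/
def latticeShift (a h : ℝ) (s : ℤ → ℤ) (q₁ q₂ i₀ j₀ : ℤ) (ρ : ℝ) {N' : ℕ} (P : Fin N' → E3)
    (j : Fin N') : E3 :=
  if hj : ∃ n i' j' : ℤ, InCyl a h s q₁ q₂ i₀ j₀ ρ n i' j' ∧ P j = barlowPos a h s n i' j'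
  then (shiftSign s q₁ hj.choose : ℝ) • barlowOffset a else 0

open Classical in
/-- **The changed-pair sum** of a displacement field `d` on a configuration `x`: over the pairs whose
two endpoints move by different vectors, new minus old pair energy. [folklore] -/
def changedPairSum (V : ℝ → ℝ) {N : ℕ} (x d : Fin N → E3) : ℝ :=
  ∑ i, ∑ j ∈ Finset.Ioi i,
    if d i = d j then 0 else (V (dist (x i + d i) (x j + d j)) - V (dist (x i) (x j)))

/-- **`E(x + d) - E(x)` is the changed-pair sum**: a pair moved rigidly keeps its distance.
[folklore] -/
theorem interactionEnergy_add_sub : ∀ (V : ℝ → ℝ) {N : ℕ} (x d : Fin N → E3),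
    interactionEnergy V (x + d) - interactionEnergy V x = changedPairSum V x d := by
  intro V N x d
  classical
  unfold interactionEnergy changedPairSum
  rw [← Finset.sum_sub_distrib]
  refine Finset.sum_congr rfl fun i _ => ?_
  rw [← Finset.sum_sub_distrib]
  refine Finset.sum_congr rfl fun j _ => ?_
  simp only [Pi.add_apply]
  split_ifs with hij
  · rw [hij, dist_add_right, sub_self]
  · rfl

/-- **The ground-state comparison**: if `x` is a Lennard-Jones ground state and the competitor
`x + d` is injective then the changed-pair sum is `≥ 0` (`groundStateEnergy_lennardJones_le`).
[folklore] -/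
theorem changedPairSum_nonneg_of_isGroundState {N : ℕ} {x d : Fin N → E3}
    (hx : IsGroundState lennardJones x) (hinj : Function.Injective (x + d)) :
    0 ≤ changedPairSum lennardJones x d := by
  rw [← interactionEnergy_add_sub lennardJones x d]
  have h1 := groundStateEnergy_lennardJones_le (d := 3) hinj
  rw [← hx.2] at h1
  linarith

end Summit.AtomisticToContinuum.Crystallization.Theorems.SquareWellLayerCake.StackingFaultSparsity

end
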